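import Summits.SmoothPoincare4.SmoothPoincare4.Theorems.ConvexBisectionAcyclicBisectionRigidityStubDoubleHalfContractible
import Literature.Topology.FourManifolds.Handles
import Literature.Topology.FourManifolds.Gluing
import Literature.Geometry.Symplectic.SteinDomain
import Literature.Topology.FourManifolds.MazurDouble
import Mathlib.Geometry.Manifold.Diffeomorph
import HarnessLib

/-!
# Stub `stub_mazurDouble` of line `seam-duality-cancellation` for crux `ConvexBisection.AcyclicBisectionRigidity`
(item stmt-SmoothPoincare4-10507, route route-SmoothPoincare4-ConvexBisection)

The PARALLEL HORN of the line (Stub 3 of the lead's skeleton, reshape s3, 2026-08-16): a homotopy `4`-sphere `P`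
which is the double `D(W) = W ∪_id W` (`IsDouble b (𝓡 4) P`) of a compact `4`-manifold `W` with a handle
decomposition into one `0`-, one `1`-, one `2`-handle (`HasHandleDecomposition 3 W (1,1,1,0,…)`), `W` ℚ-acyclic (and
Stein, unused), is diffeomorphic to `S⁴` — modulo ONE named fact, Mazur's theorem, fed in as the leading hypothesis
`hMazur` (fact-stub `stub_factMazur` of the skeleton; the same pattern as the facts C, E, R, L, T of the other stubs).

STEP 0 (landed, p89382): `W` is CONTRACTIBLE (`ExchangeRecognition.stub_doubleHalfContractible`: fold retraction of the
double, `π₁(S⁴) = 1`, duality, Whitehead).  What remains is EXACTLY Mazur's theorem: *the double of a Mazur manifold —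
a compact contractible `4`-manifold `H⁰ ∪ H¹ ∪ H²` — is `S⁴`* (Mazur 1961: `W × I ≅ B⁵`, so `D(W) = ∂(W × I) ≅ S⁴`;
Aitchison–Rubinstein 1984, Lemma 5.4), stated below in the tree's vocabulary as the named fact
`Mazur1961_double_sphere_four` (wave-1 worker of the lead, verified against the held text of AR 1984 Lemma 5.4).
The tree cannot prove it today: no product `W × [0, 1]` of a manifold with boundary (corners; `DoubleThickening.lean`),
and the 5-dimensional `1/2`-handle cancellation is itself the named fact
`IsPresentationHandlebodyFive.nonempty_diffeomorph_closedBall_of_isStablyAndrewsCurtisEquivalent`.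

## References

* B. Mazur, *A note on some contractible 4-manifolds*, Ann. of Math. 73 (1961), 221–228. [Mazur1961]
* I. R. Aitchison, J. H. Rubinstein, *Fibered knots and involutions on homotopy spheres*, in: Four-manifold theory
  (Durham, N.H., 1982), Contemp. Math. 35, AMS (1984), Lemma 5.4. [AitchisonRubinstein1984]
* S. Akbulut, R. Kirby, *Mazur manifolds*, Michigan Math. J. 26 (1979), 259–284. [AkbulutKirby1979]
-/

noncomputable section

-- The namespace is prescribed by the crux protocol (`Summit.<P>.<Sub>.Theorems.<Crux>.<Line>`
-- with `P = Sub = SmoothPoincare4`), hence the duplicated component.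
set_option linter.dupNamespace false

open scoped Manifold ContDiff Topology ContinuousMap
open Set Function Literature.Topology.FourManifolds Literature.Geometry.Symplectic
  Literature.AlgebraicTopology.SingularHomology CategoryTheory.Limits

namespace Summit.SmoothPoincare4.SmoothPoincare4.Theorems.AcyclicBisectionRigidity.SeamDualityCancellation

/-- **The stub from Mazur's theorem.**  Under the data of `stub_mazurDouble` the half `W` is
contractible (LANDED `ExchangeRecognition.stub_doubleHalfContractible`, p89382: the fold retraction
`D(W) → W` makes `W` a retract of the homotopy `4`-sphere `P`, hence simply connected with
`H₁ = H₂ = H₃ = 0`, and a compact simply connected `4`-manifold with connected nonempty boundary and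
`H₁ = H₂ = 0` is contractible), so `W` is a Mazur manifold and the fact
`Mazur1961_double_sphere_four` concludes.  The Stein datum `_J` and, beyond Step 0, the ℚ-acyclicity
and the homotopy equivalence are not used. [cite: AitchisonRubinstein1984, Lemma 5.4] -/
theorem stub_mazurDouble (hMazur : Mazur1961_double_sphere_four)
    (W : Type) [TopologicalSpace W] [T2Space W] [SecondCountableTopology W]
    [ChartedSpace (EuclideanHalfSpace 4) W] [IsManifold (𝓡∂ 4) ∞ W] [CompactSpace W]
    (_J : SteinStructure W) (hW : HasHandleDecomposition 3 W (fun k => if k ≤ 2 then 1 else 0))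
    (hac : ∀ k, 0 < k → IsZero (singularHomology ℚ ℚ W k))
    (b : BoundaryData (𝓡∂ 4) W (𝓡 3))
    (P : Type) [TopologicalSpace P] [T2Space P] [SecondCountableTopology P]
    [ChartedSpace (EuclideanSpace ℝ (Fin 4)) P]
    [IsManifold (𝓡 4) ∞ P] (hP : P ≃ₕ Metric.sphere (0 : EuclideanSpace ℝ (Fin 5)) 1)
    (hD : IsDouble b (𝓡 4) P) :
    Nonempty (P ≃ₘ⟮𝓡 4, 𝓡 4⟯ Metric.sphere (0 : EuclideanSpace ℝ (Fin 5)) 1) := by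
  haveI : ContractibleSpace W := ExchangeRecognition.stub_doubleHalfContractible W hac b P hD hP
  exact hMazur W hW b P hD

end Summit.SmoothPoincare4.SmoothPoincare4.Theorems.AcyclicBisectionRigidity.SeamDualityCancellation

end
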